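import Literature.NumberTheory.LFunctions.Zhang2022.Section2Assembly

/-!
# Zhang (2022) §2: the exact second-order structure of the skeleton, and its degenerate designs

Companion to `Section2Assembly` (repair cell `pub-zhang`: audit + repair census of Y. Zhang,
*Discrete mean estimates and the Landau–Siegel zero*, arXiv:2211.02515v1 (2022)
[Zhang2022LandauSiegel]; the cell's verdict on that manuscript is NEGATIVE — the printed inequality
(8.24) fails, `Zhang2022.not_ineq824` — and **this file makes no claim about its Theorems 1–2 and
no claim about Landau–Siegel zeros**). Everything here is finite-sum algebra over the datum
`EndgameData` of `Section2Assembly` ((2.16)–(2.20), (2.32)–(2.33)): weights `𝔠* ≥ 0` (Lemma 2.3),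
`ω > 0`, `|Z| = 1`, arbitrary complex values `H₁ H₂ J₁ J₂`. No asymptotics, no number theory.

`Section2Assembly.EndgameData.false_of_closing` isolates the closing condition of §2:
`√(q·c_J) + ε < d` for the five inputs `|Ξ₁*| ≥ d𝔞𝔓`, `Ξ₁ ≤ q𝔞𝔓`, `Ξ_J ≤ c_J𝔞𝔓`, `Ξ₃* ≤ ε𝔞𝔓`
and (2.18). The cell's ALT seat 2 (`b2b-zhang-alt-2/ALT-2.md`) found that over the whole admissible
design class the MAIN-ORDER margin `√(C₂₃₂C₂₃₃) − |𝔡′+𝔡|` is `≥ 0`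
(`MainTermFormCauchySchwarz`), with equality exactly on the locus of `MainTermFormCSEquality`;
on that locus the decision passes to lower-order terms the manuscript never computes (census cell
V12 (a)). This file supplies the EXACT (all-orders) bookkeeping behind that cell.

**Proved here (axioms `propext`, `Classical.choice`, `Quot.sound`).** For `t ∈ ℂ` put
`G_t := H₁ + ZH̄₂ − tJ₁` (`ghost`), `γ(t) := Σ 𝔠* J̄₁ G_t ω` (`kernelPairing`) and
`δ := Σ 𝔠* H̄₂ (J₂ − ZJ̄₁) ω` (`afeDefectCross`; this is the second term of the first display
before (2.18), summed).
* `xiStar1_eq_decomp` — `Ξ₁* = t·Ξ_J + γ(t) + δ`; `xi1_eq_decomp` —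
  `Ξ₁ = |t|²Ξ_J + 2Re(t̄γ(t)) + 𝔉(G_t)` (`𝔉` = the form (2.16), `form216`);
  `norm_afeDefectCross_le_xiStar3` — `|δ| ≤ Ξ₃*` (second display before (2.18)).
* **`normSq_xiStar1_sub_xi1_mul_xiJ`** — the exact identity, for every `t`:
  `|Ξ₁*|² − Ξ₁Ξ_J = 2Ξ_J·Re(t̄δ) + |Ξ₁* − tΞ_J|² − Ξ_J·𝔉(G_t)`; hence
  `normSq_xiStar1_le_secondOrder`: `|Ξ₁*|² ≤ Ξ₁Ξ_J + 2|t|Ξ_JΞ₃* + |Ξ₁* − tΞ_J|²`.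
* ONE-SIDED designs (`H₂ = 0`): `Ξ₃* = 0`, `δ = 0` (`xiStar3_eq_zero_of_oneSided`,
  `afeDefectCross_eq_zero_of_oneSided`), so `|Ξ₁*|² − Ξ₁Ξ_J = |Ξ₁* − tΞ_J|² − Ξ_J𝔉(G_t)` and, at
  `t₀ = Ξ₁*/Ξ_J`, **`cs_deficit_eq_of_oneSided`: `Ξ₁Ξ_J − |Ξ₁*|² = Ξ_J · 𝔉(G_{t₀})`** — the
  Cauchy–Schwarz deficit of the §2 skeleton at a one-sided design IS the form (2.16) at the single
  test function `G_{t₀}` (the "direct" route the manuscript declines, p. 5); and Prop. 2.6 plays no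
  role (`le_sqrt_of_oneSided`: the other four inputs already force `d ≤ √(q·c_J)`, `ε = 0`).
* PARALLEL designs (`H₂ = 0`, `H₁ = tJ₁` pointwise — the margin-zero directions of the designs
  R07/R08 of the ALT-2 certificate `alt2_cert_B.json`, kit job j055008, are of this form):
  `G_t = 0`, **`Ξ₁* = tΞ_J`, `Ξ₁ = |t|²Ξ_J`,
  `Ξ₂* = |t|Ξ_J`, `Ξ₃* = 0` exactly**, so (2.18) holds WITH EQUALITY
  (`norm_xiStar1_eq_xiStar2_add_xiStar3_of_parallel`) and `|Ξ₁*|² = Ξ₁Ξ_J`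
  (`normSq_xiStar1_eq_xi1_mul_xiJ_of_parallel`): the two-test-function mechanism of §2 degenerates
  to statements about the single mean `Ξ_J`, and **`not_exists_scale_of_closing`**: if
  `√(q·c_J) < d` then NO real value `X` of `Ξ_J/𝔞𝔓` satisfies `d ≤ |t|X`, `|t|²X ≤ q`, `X ≤ c_J`
  — at a parallel design the closing condition can only be met by bounds on one and the same mean
  that are already mutually inconsistent, at every order; nothing of (2.17)–(2.20) is used.
* The DUAL prototype (`H₁ = 0`, `H₂ = J₂`): `Ξ₁* = Ξ₁ = Σ𝔠*|J₂|²ω` exactly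
  (`xiStar1_eq_of_dual`, `xi1_eq_of_dual`), `|Ξ₁ − Ξ₂*| ≤ Ξ₃*` (`abs_xi1_sub_xiStar2_le_of_dual`),
  so the slack of (2.18) lies in `[0, 2Ξ₃*]` (`slack218_le_of_dual`): there the whole decision is
  a question about the size of `Ξ₃*` beyond Prop. 2.6's `o(𝔞𝔓)`.

Census reading (ALT-2.md §10; rows V12 (a) / V18): the margin-zero directions of the instances
R07/R08 computed in the cell are parallel one-sided designs and are thereby DECIDED (cannot close at
any order within the manuscript's mechanism: one asymptotic evaluation per discrete mean); moreover
a one-sided design of the admissible class (all lengths `< 1`) has main-order margin zero only if it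
is parallel (an element of the AFE span vanishing on an interval `[θ,1]`, `θ < 1`, is zero), so the
one-sided part of V12 (a) is decided. What remains of V12 (a) are TWO-SIDED margin-zero designs
(a genuine `H₂`-part, possibly carrying a kernel ("ghost") component `G`), for which closing is
equivalent to second-order information on `δ`, `Ξ₃*` (and `γ`, `𝔉(G)`) — quantities whose main
terms vanish and for which the manuscript proves only `o(𝔞𝔓)` upper bounds (Prop. 2.6). That
lies outside the manuscript. All declarations are elementary and tagged `[folklore]` unless they
transcribe a display of §2.
-/

noncomputable section

open Complex Real ComplexConjugate Finset

namespace Literature.NumberTheory.LFunctions.Zhang2022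

namespace EndgameData

variable {ι : Type*} [Fintype ι] (E : EndgameData ι)

/-! ## The three second-order objects -/

/-- The ghost of a design relative to the scale `t`: `G_t := H₁ + ZH̄₂ − tJ₁` (the part of the
test vector of (2.32) not parallel to `J₁`). [folklore] -/
def ghost (t : ℂ) (i : ι) : ℂ := E.H₁ i + E.Z i * conj (E.H₂ i) - t * E.J₁ i

/-- The kernel pairing `γ(t) := Σ 𝔠* J̄₁ G_t ω`. [folklore] -/
def kernelPairing (t : ℂ) : ℂ := ∑ i, (E.cstar i : ℂ) * (conj (E.J₁ i) * E.ghost t i) * E.omega i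

/-- The AFE-defect cross mean `δ := Σ 𝔠* H̄₂ (J₂ − ZJ̄₁) ω` — the second term of the first display
before (2.18), summed over the family. [cite: Zhang2022LandauSiegel, §2, proof of (2.18)] -/
def afeDefectCross : ℂ :=
  ∑ i, (E.cstar i : ℂ) * (conj (E.H₂ i) * (E.J₂ i - E.Z i * conj (E.J₁ i))) * E.omega i

/-- The form (2.16) as a complex number: `𝔉(h) = Σ 𝔠* h h̄ ω`. [folklore] -/
theorem ofReal_form216 (h : ι → ℂ) :
    (E.form216 h : ℂ) = ∑ i, (E.cstar i : ℂ) * (h i * conj (h i)) * E.omega i := by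
  unfold form216
  push_cast
  refine Finset.sum_congr rfl fun i _ => ?_
  rw [Complex.mul_conj, Complex.normSq_eq_norm_sq]
  push_cast
  ring

/-! ## The decompositions of `Ξ₁*` and `Ξ₁` along `J₁` -/

/-- `Ξ₁* = t·Ξ_J + γ(t) + δ` for every `t` (first display before (2.18), with
`H₁ + ZH̄₂ = tJ₁ + G_t`). [folklore] -/
theorem xiStar1_eq_decomp (t : ℂ) :
    E.xiStar1 = t * E.xiJ + E.kernelPairing t + E.afeDefectCross := by
  rw [xiJ_eq_form216, ofReal_form216]
  unfold xiStar1 kernelPairing afeDefectCross ghost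
  rw [Finset.mul_sum, ← Finset.sum_add_distrib, ← Finset.sum_add_distrib]
  refine Finset.sum_congr rfl fun i _ => ?_
  ring

/-- `Ξ₁ = |t|²Ξ_J + 2Re(t̄γ(t)) + 𝔉(G_t)` for every `t`
(`|tJ₁ + G|² = |t|²|J₁|² + 2Re(t̄J̄₁G) + |G|²`). [folklore] -/
theorem xi1_eq_decomp (t : ℂ) :
    E.xi1 = ‖t‖ ^ 2 * E.xiJ + 2 * (conj t * E.kernelPairing t).re + E.form216 (E.ghost t) := by
  have hre : (conj t * E.kernelPairing t).re
      = ∑ i, E.cstar i * (conj t * (conj (E.J₁ i) * E.ghost t i)).re * E.omega i := by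
    unfold kernelPairing
    rw [Finset.mul_sum, Complex.re_sum]
    refine Finset.sum_congr rfl fun i _ => ?_
    have : conj t * ((E.cstar i : ℂ) * (conj (E.J₁ i) * E.ghost t i) * (E.omega i : ℂ))
        = (E.cstar i : ℂ) * (conj t * (conj (E.J₁ i) * E.ghost t i)) * (E.omega i : ℂ) := by ring
    rw [this, Complex.re_mul_ofReal, Complex.re_ofReal_mul]
  rw [hre]
  unfold xi1 xiJ form216
  rw [Finset.mul_sum, Finset.mul_sum, ← Finset.sum_add_distrib, ← Finset.sum_add_distrib]
  refine Finset.sum_congr rfl fun i _ => ?_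
  have hG : E.H₁ i + E.Z i * conj (E.H₂ i) = t * E.J₁ i + E.ghost t i := by
    simp only [ghost]; ring
  rw [hG]
  simp only [Complex.sq_norm, Complex.normSq_apply, Complex.add_re, Complex.add_im, Complex.mul_re,
    Complex.mul_im, Complex.conj_re, Complex.conj_im]
  ring

/-- `|δ| ≤ Ξ₃*` (termwise `|H̄₂(J₂ − ZJ̄₁)| = |J₁ − ZJ̄₂||H₂|`, second display before (2.18), and
`𝔠*ω ≥ 0`). [cite: Zhang2022LandauSiegel, §2, proof of (2.18)] -/
theorem norm_afeDefectCross_le_xiStar3 : ‖E.afeDefectCross‖ ≤ E.xiStar3 := by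
  unfold afeDefectCross xiStar3
  refine (norm_sum_le _ _).trans (Finset.sum_le_sum fun i _ => le_of_eq ?_)
  rw [norm_mul, norm_mul, Complex.norm_real, Complex.norm_real,
    Real.norm_of_nonneg (E.cstar_nonneg i), Real.norm_of_nonneg (E.omega_pos i).le, norm_mul,
    Complex.norm_conj, norm_sub_rev (E.J₂ i), norm_Z_mul_conj_sub (E.norm_Z i)]
  ring

/-! ## The exact second-order identity -/

/-- **The exact identity.** For every `t ∈ ℂ`:
`|Ξ₁*|² − Ξ₁·Ξ_J = 2Ξ_J·Re(t̄δ) + |Ξ₁* − tΞ_J|² − Ξ_J·𝔉(G_t)`.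
With `t` the main-order ratio of a margin-zero design, every term on the right has vanishing main
term: the sign of the left side — i.e. whether (2.18) with Cauchy–Schwarz can contradict the four
discrete-mean inputs — is decided by `δ`, `γ`, `𝔉(G)` at second order. [folklore] -/
theorem normSq_xiStar1_sub_xi1_mul_xiJ (t : ℂ) :
    ‖E.xiStar1‖ ^ 2 - E.xi1 * E.xiJ
      = 2 * E.xiJ * (conj t * E.afeDefectCross).re + ‖E.xiStar1 - t * E.xiJ‖ ^ 2
        - E.xiJ * E.form216 (E.ghost t) := by
  rw [E.xi1_eq_decomp t, E.xiStar1_eq_decomp t]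
  generalize E.kernelPairing t = γ
  generalize E.afeDefectCross = δ
  generalize E.form216 (E.ghost t) = σ
  generalize E.xiJ = X
  simp only [Complex.sq_norm, Complex.normSq_apply, Complex.add_re, Complex.add_im, Complex.sub_re,
    Complex.sub_im, Complex.mul_re, Complex.mul_im, Complex.ofReal_re, Complex.ofReal_im,
    Complex.conj_re, Complex.conj_im]
  ring

/-- Consequently `|Ξ₁*|² ≤ Ξ₁Ξ_J + 2|t|·Ξ_J·Ξ₃* + |Ξ₁* − tΞ_J|²` for every `t`
(`Re(t̄δ) ≤ |t||δ| ≤ |t|Ξ₃*`, `𝔉(G_t) ≥ 0` by (2.16)). [folklore] -/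
theorem normSq_xiStar1_le_secondOrder (t : ℂ) :
    ‖E.xiStar1‖ ^ 2
      ≤ E.xi1 * E.xiJ + 2 * E.xiJ * (‖t‖ * E.xiStar3) + ‖E.xiStar1 - t * E.xiJ‖ ^ 2 := by
  have h := E.normSq_xiStar1_sub_xi1_mul_xiJ t
  have hX := E.xiJ_nonneg
  have hσ := E.form216_nonneg (E.ghost t)
  have hre : (conj t * E.afeDefectCross).re ≤ ‖t‖ * E.xiStar3 := by
    refine (Complex.re_le_norm _).trans ?_
    rw [norm_mul, Complex.norm_conj]
    exact mul_le_mul_of_nonneg_left E.norm_afeDefectCross_le_xiStar3 (norm_nonneg t)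
  nlinarith [mul_le_mul_of_nonneg_left hre hX, mul_nonneg hX hσ]

/-! ## One-sided designs: `H₂ = 0` -/

/-- If `H₂ = 0` then `Ξ₃* = 0`: Proposition 2.6 is not needed. [folklore] -/
theorem xiStar3_eq_zero_of_oneSided (hH₂ : ∀ i, E.H₂ i = 0) : E.xiStar3 = 0 := by
  simp [xiStar3, hH₂]

/-- If `H₂ = 0` then `δ = 0`. [folklore] -/
theorem afeDefectCross_eq_zero_of_oneSided (hH₂ : ∀ i, E.H₂ i = 0) : E.afeDefectCross = 0 := by
  simp [afeDefectCross, hH₂]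

/-- One-sided exact identity: `|Ξ₁*|² − Ξ₁Ξ_J = |Ξ₁* − tΞ_J|² − Ξ_J·𝔉(G_t)` for every `t`.
[folklore] -/
theorem normSq_xiStar1_sub_of_oneSided (hH₂ : ∀ i, E.H₂ i = 0) (t : ℂ) :
    ‖E.xiStar1‖ ^ 2 - E.xi1 * E.xiJ
      = ‖E.xiStar1 - t * E.xiJ‖ ^ 2 - E.xiJ * E.form216 (E.ghost t) := by
  have h := E.normSq_xiStar1_sub_xi1_mul_xiJ t
  rw [E.afeDefectCross_eq_zero_of_oneSided hH₂, mul_zero, Complex.zero_re, mul_zero, zero_add] at h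
  exact h

/-- **The Cauchy–Schwarz deficit of a one-sided design is the form (2.16) at its ghost**:
if `H₂ = 0` and `Ξ_J ≠ 0` then, with `t₀ = Ξ₁*/Ξ_J`, `Ξ₁Ξ_J − |Ξ₁*|² = Ξ_J · 𝔉(G_{t₀})`. So the §2
skeleton can contradict the discrete-mean inputs of a one-sided design only through a violation of
(2.16) by the single test function `G_{t₀} = H₁ − t₀J₁` — the direct route. [folklore] -/
theorem cs_deficit_eq_of_oneSided (hH₂ : ∀ i, E.H₂ i = 0) (hJ : E.xiJ ≠ 0) :
    E.xi1 * E.xiJ - ‖E.xiStar1‖ ^ 2 = E.xiJ * E.form216 (E.ghost (E.xiStar1 / E.xiJ)) := by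
  have h := E.normSq_xiStar1_sub_of_oneSided hH₂ (E.xiStar1 / E.xiJ)
  have h0 : E.xiStar1 - E.xiStar1 / E.xiJ * E.xiJ = 0 := by
    rw [div_mul_cancel₀ _ (Complex.ofReal_ne_zero.mpr hJ), sub_self]
  rw [h0, norm_zero, zero_pow two_ne_zero, zero_sub] at h
  linarith

/-- For a one-sided design the inputs `|Ξ₁*| ≥ d𝔞𝔓`, `Ξ₁ ≤ q𝔞𝔓`, `Ξ_J ≤ c_J𝔞𝔓` alone force
`d ≤ √(q·c_J)` (`Section2Assembly.EndgameData.le_sqrt_add_of_skeleton` with `ε = 0`): the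
tolerance `ε` granted to Proposition 2.6 buys nothing here. [folklore] -/
theorem le_sqrt_of_oneSided (hH₂ : ∀ i, E.H₂ i = 0) {aP d q cJ : ℝ} (haP : 0 < aP)
    (h24 : d * aP ≤ ‖E.xiStar1‖) (h232 : E.xi1 ≤ q * aP) (h233 : E.xiJ ≤ cJ * aP) :
    d ≤ Real.sqrt (q * cJ) := by
  have h := E.le_sqrt_add_of_skeleton (ε := 0) haP h24 h232 h233
    (by rw [E.xiStar3_eq_zero_of_oneSided hH₂, zero_mul])
  simpa using h

/-! ## Parallel designs: `H₂ = 0`, `H₁ = tJ₁` (the computed margin-zero designs R07/R08) -/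

section Parallel

variable {E} {t : ℂ} (hH₂ : ∀ i, E.H₂ i = 0) (hH₁ : ∀ i, E.H₁ i = t * E.J₁ i)
include hH₂ hH₁

omit [Fintype ι] in
/-- A parallel design has no ghost: `G_t = 0`. [folklore] -/
theorem ghost_eq_zero_of_parallel : E.ghost t = 0 := by
  funext i
  simp [ghost, hH₁ i, hH₂ i]

/-- … hence `γ(t) = 0`. [folklore] -/
theorem kernelPairing_eq_zero_of_parallel : E.kernelPairing t = 0 := by
  simp [kernelPairing, ghost_eq_zero_of_parallel hH₂ hH₁]

/-- `Ξ₁* = t·Ξ_J` exactly. [folklore] -/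
theorem xiStar1_eq_of_parallel : E.xiStar1 = t * E.xiJ := by
  rw [E.xiStar1_eq_decomp t, kernelPairing_eq_zero_of_parallel hH₂ hH₁,
    E.afeDefectCross_eq_zero_of_oneSided hH₂, add_zero, add_zero]

/-- `Ξ₁ = |t|²·Ξ_J` exactly. [folklore] -/
theorem xi1_eq_of_parallel : E.xi1 = ‖t‖ ^ 2 * E.xiJ := by
  rw [E.xi1_eq_decomp t, kernelPairing_eq_zero_of_parallel hH₂ hH₁,
    ghost_eq_zero_of_parallel hH₂ hH₁, mul_zero, Complex.zero_re, mul_zero, add_zero]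
  simp [form216]

/-- `Ξ₂* = |t|·Ξ_J` exactly. [folklore] -/
theorem xiStar2_eq_of_parallel : E.xiStar2 = ‖t‖ * E.xiJ := by
  unfold xiStar2 xiJ
  rw [Finset.mul_sum]
  refine Finset.sum_congr rfl fun i _ => ?_
  rw [hH₁ i, hH₂ i, map_zero, mul_zero, add_zero, norm_mul]
  ring

/-- `|Ξ₁*| = |t|·Ξ_J`. [folklore] -/
theorem norm_xiStar1_eq_of_parallel : ‖E.xiStar1‖ = ‖t‖ * E.xiJ := by
  rw [xiStar1_eq_of_parallel hH₂ hH₁, norm_mul, Complex.norm_real, Real.norm_of_nonneg E.xiJ_nonneg]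

/-- **(2.18) holds with equality at a parallel design**: `|Ξ₁*| = Ξ₂* + Ξ₃*`. [folklore] -/
theorem norm_xiStar1_eq_xiStar2_add_xiStar3_of_parallel : ‖E.xiStar1‖ = E.xiStar2 + E.xiStar3 := by
  rw [norm_xiStar1_eq_of_parallel hH₂ hH₁, xiStar2_eq_of_parallel hH₂ hH₁,
    E.xiStar3_eq_zero_of_oneSided hH₂, add_zero]

/-- **Cauchy–Schwarz holds with equality at a parallel design**: `|Ξ₁*|² = Ξ₁·Ξ_J`. [folklore] -/
theorem normSq_xiStar1_eq_xi1_mul_xiJ_of_parallel : ‖E.xiStar1‖ ^ 2 = E.xi1 * E.xiJ := by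
  rw [norm_xiStar1_eq_of_parallel hH₂ hH₁, xi1_eq_of_parallel hH₂ hH₁]
  ring

end Parallel

/-- **At a parallel design the closing condition is unsatisfiable by any value of the one free
mean.** If `√(q·c_J) < d` then no real `X` (read: `Ξ_J/𝔞𝔓`, to any order, true or evaluated)
satisfies `d ≤ |t|X` (`|Ξ₁*| = |t|Ξ_J ≥ d𝔞𝔓`), `|t|²X ≤ q` (`Ξ₁ = |t|²Ξ_J ≤ q𝔞𝔓`) and `X ≤ c_J`
(`Ξ_J ≤ c_J𝔞𝔓`): bounds meeting the closing condition are mutually inconsistent as bounds on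
`Ξ_J` alone, and (2.17)–(2.20) contribute nothing. [folklore] -/
theorem not_exists_scale_of_closing (t : ℂ) {d q cJ : ℝ} (hclose : Real.sqrt (q * cJ) < d) :
    ¬ ∃ X : ℝ, d ≤ ‖t‖ * X ∧ ‖t‖ ^ 2 * X ≤ q ∧ X ≤ cJ := by
  rintro ⟨X, h1, h2, h3⟩
  have hd : 0 < d := (Real.sqrt_nonneg _).trans_lt hclose
  have ht : 0 ≤ ‖t‖ := norm_nonneg t
  have hX : 0 < X := by nlinarith
  have hq : 0 ≤ q := le_trans (by positivity) h2
  have key : d ^ 2 ≤ q * cJ :=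
    calc d ^ 2 ≤ (‖t‖ * X) ^ 2 := pow_le_pow_left₀ hd.le h1 2
      _ = ‖t‖ ^ 2 * X * X := by ring
      _ ≤ q * X := mul_le_mul_of_nonneg_right h2 hX.le
      _ ≤ q * cJ := mul_le_mul_of_nonneg_left h3 hq
  have : d ≤ Real.sqrt (q * cJ) := by
    rw [← Real.sqrt_sq hd.le]
    exact Real.sqrt_le_sqrt key
  linarith

/-- The same, read on a datum: at a parallel design the three inputs force
`d·𝔞𝔓 ≤ |t|Ξ_J`, `|t|²Ξ_J ≤ q𝔞𝔓`, `Ξ_J ≤ c_J𝔞𝔓`, hence `d ≤ √(q·c_J)` whatever `Ξ_J` is.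
[folklore] -/
theorem le_sqrt_of_parallel {t : ℂ} (hH₂ : ∀ i, E.H₂ i = 0) (hH₁ : ∀ i, E.H₁ i = t * E.J₁ i)
    {aP d q cJ : ℝ} (haP : 0 < aP) (h24 : d * aP ≤ ‖E.xiStar1‖) (h232 : E.xi1 ≤ q * aP)
    (h233 : E.xiJ ≤ cJ * aP) : d ≤ Real.sqrt (q * cJ) := by
  by_contra hlt
  refine not_exists_scale_of_closing t (not_le.mp hlt) ⟨E.xiJ / aP, ?_, ?_, ?_⟩
  · rw [norm_xiStar1_eq_of_parallel hH₂ hH₁] at h24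
    rw [mul_div_assoc', le_div_iff₀ haP]
    exact h24
  · rw [xi1_eq_of_parallel hH₂ hH₁] at h232
    rw [mul_div_assoc', div_le_iff₀ haP]
    exact h232
  · rw [div_le_iff₀ haP]
    exact h233

/-! ## The dual prototype: `H₁ = 0`, `H₂ = J₂` -/

/-- If `H₁ = 0` then `Ξ₁ = Ξ₁₂ = Σ𝔠*|H₂|²ω` (`|Z| = 1`). [folklore] -/
theorem xi1_eq_xi12_of_H₁ (hH₁ : ∀ i, E.H₁ i = 0) : E.xi1 = E.xi12 := by
  unfold xi1 xi12
  refine Finset.sum_congr rfl fun i _ => ?_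
  rw [hH₁ i, zero_add, norm_mul, E.norm_Z i, one_mul, Complex.norm_conj]

/-- At the dual prototype `Ξ₁* = Σ𝔠*|J₂|²ω = Ξ₁₂`, a non-negative real. [folklore] -/
theorem xiStar1_eq_of_dual (hH₁ : ∀ i, E.H₁ i = 0) (hH₂ : ∀ i, E.H₂ i = E.J₂ i) :
    E.xiStar1 = (E.xi12 : ℂ) := by
  have h12 : E.xi12 = E.form216 E.H₂ := rfl
  rw [h12, ofReal_form216]
  unfold xiStar1
  refine Finset.sum_congr rfl fun i _ => ?_
  rw [hH₁ i, hH₂ i, zero_mul, zero_add, mul_comm (conj (E.J₂ i))]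

/-- … so `|Ξ₁*| = Ξ₁` there. [folklore] -/
theorem norm_xiStar1_eq_xi1_of_dual (hH₁ : ∀ i, E.H₁ i = 0) (hH₂ : ∀ i, E.H₂ i = E.J₂ i) :
    ‖E.xiStar1‖ = E.xi1 := by
  have h12 : 0 ≤ E.xi12 := E.form216_nonneg E.H₂
  rw [E.xiStar1_eq_of_dual hH₁ hH₂, Complex.norm_real, Real.norm_of_nonneg h12,
    E.xi1_eq_xi12_of_H₁ hH₁]

/-- At the dual prototype `|Ξ₁ − Ξ₂*| ≤ Ξ₃*` (termwise `||J₂| − |J₁|| ≤ |J₁ − ZJ̄₂|`). [folklore] -/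
theorem abs_xi1_sub_xiStar2_le_of_dual (hH₁ : ∀ i, E.H₁ i = 0) (hH₂ : ∀ i, E.H₂ i = E.J₂ i) :
    |E.xi1 - E.xiStar2| ≤ E.xiStar3 := by
  have hZJ : ∀ i, ‖E.Z i * conj (E.J₂ i)‖ = ‖E.J₂ i‖ := fun i => by
    rw [norm_mul, E.norm_Z i, one_mul, Complex.norm_conj]
  have hx : E.xi1 - E.xiStar2
      = ∑ i, E.cstar i * (‖E.J₂ i‖ * (‖E.J₂ i‖ - ‖E.J₁ i‖)) * E.omega i := by
    unfold xi1 xiStar2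
    rw [← Finset.sum_sub_distrib]
    refine Finset.sum_congr rfl fun i _ => ?_
    rw [hH₁ i, zero_add, hH₂ i, hZJ i]
    ring
  rw [hx]
  unfold xiStar3
  refine (Finset.abs_sum_le_sum_abs _ _).trans (Finset.sum_le_sum fun i _ => ?_)
  rw [abs_mul, abs_mul, abs_of_nonneg (E.cstar_nonneg i), abs_of_nonneg (E.omega_pos i).le,
    abs_mul, abs_norm, hH₂ i]
  have hkey : |‖E.J₂ i‖ - ‖E.J₁ i‖| ≤ ‖E.J₁ i - E.Z i * conj (E.J₂ i)‖ := by
    rw [← hZJ i, norm_sub_rev (E.J₁ i)]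
    exact abs_norm_sub_norm_le _ _
  calc E.cstar i * (‖E.J₂ i‖ * |‖E.J₂ i‖ - ‖E.J₁ i‖|) * E.omega i
      ≤ E.cstar i * (‖E.J₂ i‖ * ‖E.J₁ i - E.Z i * conj (E.J₂ i)‖) * E.omega i :=
        mul_le_mul_of_nonneg_right
          (mul_le_mul_of_nonneg_left (mul_le_mul_of_nonneg_left hkey (norm_nonneg _))
            (E.cstar_nonneg i)) (E.omega_pos i).le
    _ = E.cstar i * (‖E.J₁ i - E.Z i * conj (E.J₂ i)‖ * ‖E.J₂ i‖) * E.omega i := by ring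

/-- Hence at the dual prototype the slack of (2.18) is at most `2Ξ₃*`:
`0 ≤ Ξ₂* + Ξ₃* − |Ξ₁*| ≤ 2Ξ₃*` — the decision there is entirely about the size of `Ξ₃*` beyond
Proposition 2.6's `o(𝔞𝔓)`. [folklore] -/
theorem slack218_le_of_dual (hH₁ : ∀ i, E.H₁ i = 0) (hH₂ : ∀ i, E.H₂ i = E.J₂ i) :
    0 ≤ E.xiStar2 + E.xiStar3 - ‖E.xiStar1‖
      ∧ E.xiStar2 + E.xiStar3 - ‖E.xiStar1‖ ≤ 2 * E.xiStar3 := by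
  have h1 := E.norm_xiStar1_eq_xi1_of_dual hH₁ hH₂
  have h2 := (abs_le.mp (E.abs_xi1_sub_xiStar2_le_of_dual hH₁ hH₂)).1
  have h3 := E.norm_xiStar1_le
  constructor <;> linarith

end EndgameData

end Literature.NumberTheory.LFunctions.Zhang2022
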